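import Mathlib.Analysis.Matrix.Normed
import Mathlib.Analysis.SpecificLimits.Normed
import Mathlib.Analysis.Normed.Ring.Units
import Mathlib.Analysis.InnerProductSpace.PiL2
import Mathlib.LinearAlgebra.Matrix.NonsingularInverse
import HarnessLib

/-!
# K1L_D `LagrangianRenormalisationStepDesign` (stmt-AnomalousDissipation-27980), sub-stub S1′ `stub_conjugateL` (a): MATRIX BRICKS for the
# frame distortion (helper; `--supports … --as helper`)

Elementary finite-dimensional lemmas used by S1′(a) of the lead's sub-split of `stub_windowDefectL`
(`Cruxes/LagrangianRenormalisationStep/Lines/onelevel_S23_split.lean`, lead-k1l-onelevel-p1 g2): the Jacobian matrix of the coarse flow is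
read off the operator `flowDeriv` entrywise, and its INVERSE (the distortion field `G = (∇X)⁻¹` of the distorted class
`Torus.IsWeakTensorPassiveVectorDistortedOn`) inherits the entrywise closeness to the identity:
* `abs_apply_single_sub_le_opNorm` — the entries of `L − id` (`L` a continuous linear map of `EuclideanSpace ℝ ι`) are bounded by `‖L − id‖`;
* `abs_inv_sub_one_le` — if a real square matrix `D` is entrywise within `ε` of `1` and `card·ε < 1`, then `D` is invertible and `D⁻¹` is
  entrywise within `card·ε / (1 − card·ε)` of `1` (Neumann series in the `ℓ∞`-operator norm, instantiated inside the proof only).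
Infrastructure for rung F-D1.A0; NOT a proof of the crux, of Onsager's conjecture or of anomalous dissipation.
-/

set_option linter.dupNamespace false

namespace Summit.AnomalousDissipation.AnomalousDissipation.Theorems.SolenoidalFractalHomogenisation.LagrangianStep

noncomputable section

/-! ## Entries of an operator versus its operator norm -/

/-- The `(a, c)` entry of `L − id`, i.e. `(L e_c)_a − δ_{ac}`, is bounded by the operator norm `‖L − id‖`. -/
theorem abs_apply_single_sub_le_opNorm {ι : Type*} [Fintype ι] [DecidableEq ι]
    (L : EuclideanSpace ℝ ι →L[ℝ] EuclideanSpace ℝ ι) (a c : ι) :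
    |(L (EuclideanSpace.single c 1)) a - (if a = c then 1 else 0)|
      ≤ ‖L - ContinuousLinearMap.id ℝ (EuclideanSpace ℝ ι)‖ := by
  have h1 : (L (EuclideanSpace.single c 1)) a - (if a = c then 1 else 0)
      = ((L - ContinuousLinearMap.id ℝ (EuclideanSpace ℝ ι)) (EuclideanSpace.single c 1)) a := by
    simp [PiLp.single_apply]
  rw [h1]
  set v := (L - ContinuousLinearMap.id ℝ (EuclideanSpace ℝ ι)) (EuclideanSpace.single c 1) with hv
  have h2 : |v a| ≤ ‖v‖ := by
    have := EuclideanSpace.norm_eq v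
    have hsq : |v a| ^ 2 ≤ ‖v‖ ^ 2 := by
      rw [EuclideanSpace.norm_eq, Real.sq_sqrt (Finset.sum_nonneg fun i _ => sq_nonneg _), ← Real.norm_eq_abs]
      exact Finset.single_le_sum (f := fun i => ‖v i‖ ^ 2) (fun i _ => sq_nonneg _) (Finset.mem_univ a)
    exact abs_le_of_sq_le_sq' (by nlinarith [norm_nonneg v, abs_nonneg (v a)]) (norm_nonneg _) |>.2 |> fun h => by
      nlinarith [norm_nonneg v, abs_nonneg (v a), hsq, sq_nonneg (|v a| - ‖v‖)]
  have h3 : ‖v‖ ≤ ‖L - ContinuousLinearMap.id ℝ (EuclideanSpace ℝ ι)‖ := by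
    rw [hv]
    calc ‖(L - ContinuousLinearMap.id ℝ (EuclideanSpace ℝ ι)) (EuclideanSpace.single c 1)‖
        ≤ ‖L - ContinuousLinearMap.id ℝ (EuclideanSpace ℝ ι)‖ * ‖EuclideanSpace.single c (1:ℝ)‖ :=
          ContinuousLinearMap.le_opNorm _ _
      _ = ‖L - ContinuousLinearMap.id ℝ (EuclideanSpace ℝ ι)‖ := by
          rw [PiLp.norm_single, norm_one, mul_one]
  exact h2.trans h3

/-! ## Inverse of a matrix that is entrywise close to the identity -/

/-- **Inverse of a near-identity matrix.**  If `D` is entrywise within `ε` of the identity and `card · ε < 1`, then `D` is invertible and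
`D⁻¹` is entrywise within `card·ε / (1 − card·ε)` of the identity (Neumann series `D⁻¹ = Σ (1 − D)ⁿ` in the `ℓ∞`-operator norm, which is
instantiated only inside the proof). -/
theorem abs_inv_sub_one_le {n : Type*} [Fintype n] [DecidableEq n] [Nonempty n] (D : Matrix n n ℝ) {ε : ℝ} (hε : 0 ≤ ε)
    (hcard : Fintype.card n * ε < 1) (h : ∀ i j, |D i j - (1 : Matrix n n ℝ) i j| ≤ ε) (i j : n) :
    |D⁻¹ i j - (1 : Matrix n n ℝ) i j| ≤ Fintype.card n * ε / (1 - Fintype.card n * ε) := by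
  letI : NormedRing (Matrix n n ℝ) := Matrix.linftyOpNormedRing
  letI : NormedAlgebra ℝ (Matrix n n ℝ) := Matrix.linftyOpNormedAlgebra
  haveI : CompleteSpace (Matrix n n ℝ) := FiniteDimensional.complete ℝ _
  -- entries are bounded by the `ℓ∞`-operator norm, and the norm by `card ·` the entrywise bound
  have entry_le : ∀ (A : Matrix n n ℝ) (i j : n), |A i j| ≤ ‖A‖ := fun A i j => by
    rw [Matrix.linfty_opNorm_def]
    have h1 : (‖A i j‖₊ : NNReal) ≤ ∑ j', ‖A i j'‖₊ :=
      Finset.single_le_sum (f := fun j' => ‖A i j'‖₊) (fun _ _ => bot_le) (Finset.mem_univ j)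
    have h2 : (∑ j', ‖A i j'‖₊ : NNReal) ≤ (Finset.univ : Finset n).sup fun i' => ∑ j', ‖A i' j'‖₊ :=
      Finset.le_sup (f := fun i' => ∑ j', ‖A i' j'‖₊) (Finset.mem_univ i)
    have : (‖A i j‖₊ : ℝ) ≤ ((Finset.univ : Finset n).sup fun i' => ∑ j', ‖A i' j'‖₊ : NNReal) := by
      exact_mod_cast h1.trans h2
    rwa [coe_nnnorm, Real.norm_eq_abs] at this
  have norm_le : ∀ (A : Matrix n n ℝ) (δ : ℝ), 0 ≤ δ → (∀ i j, |A i j| ≤ δ) → ‖A‖ ≤ Fintype.card n * δ := by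
    intro A δ hδ hA
    rw [Matrix.linfty_opNorm_def]
    have key : ∀ i, (∑ j, ‖A i j‖₊ : NNReal) ≤ Real.toNNReal (Fintype.card n * δ) := by
      intro i
      rw [← NNReal.coe_le_coe, NNReal.coe_sum, Real.coe_toNNReal _ (by positivity)]
      calc ∑ j, ((‖A i j‖₊ : NNReal) : ℝ) = ∑ j, |A i j| := by simp only [coe_nnnorm, Real.norm_eq_abs]
        _ ≤ ∑ _j : n, δ := Finset.sum_le_sum fun j _ => hA i j
        _ = Fintype.card n * δ := by rw [Finset.sum_const, Finset.card_univ, nsmul_eq_mul]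
    have hsup : ((Finset.univ : Finset n).sup fun i => ∑ j, ‖A i j‖₊) ≤ Real.toNNReal (Fintype.card n * δ) :=
      Finset.sup_le fun i _ => key i
    calc (((Finset.univ : Finset n).sup fun i => ∑ j, ‖A i j‖₊ : NNReal) : ℝ)
        ≤ (Real.toNNReal (Fintype.card n * δ) : ℝ) := by exact_mod_cast hsup
      _ = Fintype.card n * δ := Real.coe_toNNReal _ (by positivity)
  -- `t := 1 − D`, `‖t‖ ≤ card·ε < 1`
  set t : Matrix n n ℝ := 1 - D with ht_def
  have ht_entry : ∀ i j, |t i j| ≤ ε := fun i j => by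
    rw [ht_def, Matrix.sub_apply, abs_sub_comm]; exact h i j
  have htn : ‖t‖ ≤ Fintype.card n * ε := norm_le t ε hε ht_entry
  have ht1 : ‖t‖ < 1 := htn.trans_lt hcard
  have hD : D = 1 - t := by rw [ht_def]; abel
  -- `D⁻¹ = (1 − t)⁻¹ʳ =: S`, `(1 − t) S = 1`, `‖S‖ ≤ (1 − ‖t‖)⁻¹`
  have hU : IsUnit (1 - t) := isUnit_one_sub_of_norm_lt_one ht1
  set S : Matrix n n ℝ := Ring.inverse (1 - t) with hS_def
  have hinv : D⁻¹ = S := by rw [Matrix.nonsing_inv_eq_ringInverse, hD]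
  have hmul : (1 - t) * S = 1 := Ring.mul_inverse_cancel _ hU
  have hdiff : D⁻¹ - 1 = t * S := by
    rw [hinv]
    have h' : S - t * S = 1 := by
      have h2 := hmul
      rw [sub_mul, one_mul] at h2
      exact h2
    calc S - 1 = S - (S - t * S) := by rw [h']
      _ = t * S := sub_sub_cancel _ _
  have hS : ‖S‖ ≤ (1 - ‖t‖)⁻¹ := by
    have := tsum_geometric_le_of_norm_lt_one t ht1
    rw [geom_series_eq_inverse t ht1] at this
    simp only [norm_one, sub_self, zero_add] at this
    exact this
  have hnorm : ‖D⁻¹ - 1‖ ≤ ‖t‖ * (1 - ‖t‖)⁻¹ := by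
    rw [hdiff]
    exact (norm_mul_le _ _).trans (mul_le_mul_of_nonneg_left hS (norm_nonneg _))
  have hfin : ‖t‖ * (1 - ‖t‖)⁻¹ ≤ Fintype.card n * ε / (1 - Fintype.card n * ε) := by
    rw [← div_eq_mul_inv]
    have h1 : 0 < 1 - Fintype.card n * ε := by linarith
    have h2 : 0 < 1 - ‖t‖ := by linarith
    rw [div_le_div_iff₀ h2 h1]
    nlinarith [norm_nonneg t]
  calc |D⁻¹ i j - (1 : Matrix n n ℝ) i j| = |(D⁻¹ - 1) i j| := by rw [Matrix.sub_apply]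
    _ ≤ ‖D⁻¹ - 1‖ := entry_le _ i j
    _ ≤ _ := hnorm.trans hfin


end

end Summit.AnomalousDissipation.AnomalousDissipation.Theorems.SolenoidalFractalHomogenisation.LagrangianStep
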